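import Mathlib
import HarnessLib
import HarnessLib.Audit
import Summits.HubbardSuperconductivity.Statement
import Literature.MathematicalPhysics.QuantumLattice.PairCorrelationsProofs
import HarnessLib.Audit.Status.Attr

/-!
Route: ParityGapRigidity

Route ParityGapRigidity — HubbardSuperconductivity/HubbardSuperconductivity (realises idea card
parity-gap-lemma-rigidity; planner plancard 2026-08-15).

THESIS X (it suffices to show) := ParityGapClustering ∧ IncommensurateRigidity ∧ GappedWindow —
three statements over existing declarations only (hubbardTorus, szSector, Matrix.minEnergyOn,
groundEnergy, oneParticleRDM, twoParticleRDM, pairField dWaveFormFactor, torusDist,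
creation/annihilation, expect); all elaborate today.
(L) ParityGapClustering [sector-relative Hastings–Koma; provable now]: for every U and Δ>0 there are
C, m>0 such that on every torus (ℤ/Lℤ)² and in every sector (N, S^z=0), a normalised sector ground
state ψ of hubbardTorus 2 L 1 U whose ONE-PARTICLE CHARGE GAP about its own energy is at least 2Δ —
E(N+1)+E(N−1)−2E₀(N,0) ≥ 2Δ, the Matveev–Larkin parity gap, an energies-only datum — has |⟨ψ,
c†_{xσ} c_{yτ} ψ⟩| ≤ C·exp(−m·torusDist(x,y)).
(R) IncommensurateRigidity [the bet; Lieb–Schultz–Mattis/Oshikawa-type]: for every U>0 and δ∈(0,1/2)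
(non-integer filling 1−δ per site), if uniformly in even L ≥ L₀ every (N_L,0)-sector ground state,
N_L = 2⌊(1−δ)L²/2⌋, has (H1) exponentially decaying one-particle density matrix, (H2) normal
fluctuations Var_ψ(A) ≤ C·L² for every one-body operator A = Σ a(p) c†_{p₁}c_{p₂} with |a| ≤ 1
supported on pairs at torus distance ≤ 1 (no charge/spin/bond/current density-wave order at any
wavevector), (H3) at most D eigenvalues of H restricted to the sector below E₀ + c/L (no gapless
neutral continuum, no topological quasi-degeneracy — plain insulators PASS), (H4) E(N_L±2) −
½[E(N_L)+E(N_L±4)] ≤ C/L² (no charge-4e staircase, no z=1 critical point — insulators and 2e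
superconductors PASS), THEN every such ground state has Yang ODLRO uniformly: a unit pair
wavefunction v with Re v†ρ₂(ψ)v ≥ a·L².
(W) GappedWindow [pure t'=0 model; finite-volume hypotheses only]: there exist U>0, δ∈(0,1/2) at
which the parity gap PG holds uniformly (some Δ>0, all even L ≥ L₀) together with (H2), (H3), (H4)
and d-wave dominance κ·L²·Re v†ρ₂(ψ)v ≤ ⟨ψ, Δ_d†Δ_d ψ⟩ for every unit v (the nearest-neighbour B1g
pair field captures a fixed fraction of the largest pair eigenvalue; trivially true without ODLRO,
it only pins the channel).
ASSEMBLY X → S (bookkeeping; the composition W ⊢ PG ⇒(L) H1 ⇒(R) uniform Yang ODLRO was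
machine-checked in the planner's sketch): dominance × Yang gives ⟨Δ_d†Δ_d⟩_ψ ≥ κaL⁴ for every
(N_L,0)-sector ground state at even L ≥ L₁; for any sequence as in the Statement, Σ_{x,y∈halfOpenBox
2 (2k)} torusPullback (pairFieldCorr dWaveFormFactor ψ) (2k) x y = Re⟨pairField† pairField⟩
(pairField = Σ_x localPair; torusProj_bijOn_halfOpenBox), bounded by c·L⁴, hence liminf ≥ κa > 0,
i.e. HubbardSuperconductivity.
One-line Lean: X := ParityGapClustering ∧ IncommensurateRigidity ∧ GappedWindow;  Assembly :
ParityGapClustering → IncommensurateRigidity → GappedWindow → HubbardSuperconductivity.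

Rationale: WHY THIS LINE. Superconductivity forced by arithmetic: a non-integer number of electrons per cell
cannot hide behind a charge-e gap without a density wave, topological degeneracy or a gapless
neutral continuum (Lieb–Schultz–Mattis/flux insertion: Oshikawa2000, Oshikawa2003, HastingsPRB2004,
NachtergaeleSimsCMP2007, BachmannEtAl2021; physics form ParamekantiVishwanath2004,
ElseThorngrenSenthil2021), so what is left must condense pairs. The only model input is an odd–even
energy staircase (MatveevLarkin1997): a two-point/energies-only datum that constructive fermionic
methods and certified numerics can reach, unlike order itself. Imported areas: quasi-locality
(fermionic Lieb–Robinson NachtergaeleSimsYoung2018; clustering HastingsKoma2006,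
NachtergaeleSims2006) for the Lemma; LSM flux-insertion/index theory for R. Catalogue entries used:
rigidity & classification (a stronger structural theorem from which S drops out) + spectral
reformulation (sector energies instead of a quartic correlator).
RANKED CRUXES. (2) IncommensurateRigidity — a new LSM-type theorem, open even for hard-core bosons;
its hypotheses are chosen so that plain insulators PASS (non-integer filling is load-bearing;
compressibility is deliberately NOT assumed, which keeps it distinct from the yrast/sum-rule
mechanism) while 4e condensates (H4), Bose surfaces/orthogonal metals/spinon surfaces (H3;
MotrunichFisher2007), density waves (H2), z=1 critical points (H4) and topological pair insulators
(H3) fail. (3) GappedWindow — the pure t'=0 model must own a fully one-particle-gapped,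
non-density-wave, B1g-dominated window (candidate: chiral d+id sliver at the B1g/B2g Kohn–Luttinger
crossing, n≈0.55–0.65, RaghuKivelsonScalapino2010; nodal d_{x²−y²} has parity gap ~v_Δ/L only). (4)
ParityGapClustering — sector-relative Hastings–Koma: after H−μ_L·N with μ_L=(E(N+1)−E(N−1))/2 only
the one-sided gaps on the N±1 sides enter; the N±2 Goldstone tower is harmless.
KILL CRITERIA. NoUniformParityGap (filed as support, ¬PG for all U>0, 0<δ<1/2): its proof closes the
route. A lattice model obeying (H1)–(H4) at non-integer filling with provably no ODLRO kills R's
mechanism: close unless a clause that still lets insulators pass repairs it. ED/DMRG maps of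
L·[E(N_L±1) − hull] are the refuter instrument for W (Fermi-liquid scaling 1/L² throughout U ≤ 4
would leave only astronomically large L₀).
NOT DECOMPOSED YET. R's first split (≤ 3 children): bosonic core (hard-core bosons / spin-½ XY at
generic magnetisation = converse Oshikawa–Yamanaka–Affleck), fermion→pair reduction under (H1),
glue. W by window. The assembly's pair-field bookkeeping. No definition requests needed.
NOVELTY (searched 2026-08-15: crossref rows for Tada–Koma doi:10.1007/s10955-016-1629-2
(Bloch/Elitzur, not clustering), lit read arXiv:math-ph/0505022 = Koma2007 Thm 3 (intra-sector gap,
D<2, stretched exponential), barrier file LROForcesLowLyingStates (vendors HastingsKoma2006 Thm 2.8,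
global gap), galaxy "ersatz Fermi liquid" → Sachdev, Quantum Phases of Matter; the card's crossref
searches for ElseThorngrenSenthil2021, ParamekantiVishwanath2004, Oshikawa2000/2003,
MatveevLarkin1997). Nearest prior art: HastingsKoma2006 (global gap) and Koma2007 (intra-sector gap,
D<2) for the Lemma; Oshikawa2000/HastingsPRB2004/NachtergaeleSimsCMP2007/BachmannEtAl2021 (gapped ⇒
commensurate-or-degenerate, never the converse) and ElseThorngrenSenthil2021 (anomaly trichotomy,
non-rigorous) for R. Delta: parity gap as energies-only hypothesis + sector-relative clustering + R
as a theorem target whose hypotheses let insulators pass — new-combination; R proved even for bosons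
would be a new mechanism.
BARRIERS (technique_class: exponential-clustering LSM-commensurability spectral-data):
LROForcesLowLyingStates used, not fought (gaps only in ODD sectors; H3 counts states INSIDE sector
N; the N±2 tower is allowed, H4 only bounds its curvature at O(1/L²)); WeakCouplingCeiling and
PerturbativeInvisibilityOfPairing bite W in the weak-coupling chiral sliver (Δ flat in U) — the bet
is that PG is a two-point datum reachable before order, and W may sit at intermediate U;
GeneralizedHartreeFockNoPairing: no quasi-free variational step; PureModelStripeCompetition: stripes
violate H2, W avoids U≈8, δ≈1/8; SignProblemNPHard: numerics are refuter instruments only;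
StrongCouplingCeiling, PositiveTemperatureNoPairLRO, HohenbergMerminWagnerPairing: T=0 and no
atomic-limit expansion — not in class.

Novelty: Nearest prior art (searched before claiming, 2026-08-15): HastingsKoma2006 Thm 2.8 /
NachtergaeleSims2006 Thm 2 (exponential clustering of bosonic AND fermionic observables under a
GLOBAL gap above the ground sector — vendored in
Literature.Barriers.HubbardSuperconductivity.LROForcesLowLyingStates); Koma2007 =
arXiv:math-ph/0505022 Thm 3 and its fermion corollary (read: decay of ⟨c†_m c_n⟩_{0,N} from a gap
INSIDE the fixed-N sector, dimensions D<2 only, stretched-exponential — a Mermin–Wagner mechanism,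
not ours); Oshikawa2000 (doi:10.1103/physrevlett.84.1535), Oshikawa2003
(doi:10.1103/physrevlett.90.236401), HastingsPRB2004, NachtergaeleSimsCMP2007, BachmannEtAl2021
(doi:10.1063/5.0021511) — all prove "uniquely gapped ⇒ commensurate / degenerate", never a converse
producing order; ParamekantiVishwanath2004 and ElseThorngrenSenthil2021
(doi:10.1103/physrevx.11.021005) give the physics trichotomy (break U(1), break translations, or
carry an ersatz Fermi surface) non-rigorously; MatveevLarkin1997 (parity effect) supplies the
hypothesis; Tada–Koma 2016 (doi:10.1007/s10955-016-1629-2, checked: Bloch/Elitzur theorems,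
unrelated to clustering); galaxy search "ersatz Fermi liquid" → Sachdev, Quantum Phases of Matter
(textbook LSM/filling chapter, no converse theorem). Not found anywhere: (a) the clustering lemma
stated with gaps only in the odd charge sectors N±1 (after the shift H−μ_L N), (b) an LSM-converse
stated as a theorem target whose hypotheses (normal neutral fluctuations,  [refs: 10.1103/physrevlett.84.1535, 10.1103/physrevlett.90.236401, 10.1063/5.0021511, 10.1103/physrevx.11.021005, 10.1007/s10955-016-1629-2, math-ph/0505022, doi:10.1103/physrevlett.84.1535, doi:10.1103/physrevlett.90.236401, doi:10.1063/5.0021511, doi:10.1103/physrevx.11.021005, doi:10.1007/s10955-016-1629-2, HastingsKoma2006, NachtergaeleSims2006, Koma2007, Oshikawa2000, Oshikawa2003, HastingsPRB2004, ]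

Barriers (technique_class: exponential-clustering LSM-commensurability spectral-data): technique_class: exponential-clustering LSM-commensurability spectral-data
- Literature.Barriers.HubbardSuperconductivity.LROForcesLowLyingStates: used, not fought —
ParityGapClustering needs gaps only in the ODD charge sectors N±1 reached by c, c†;
IncommensurateRigidity's (H3) counts eigenvalues INSIDE the fixed-(N_L,0) sector, where a
superconductor has only the phonon 2πc_s/L above its (≤ D) ground states; the Horsch–von der
Linden/Koma–Tasaki low-lying states live in sectors N±2 and are explicitly allowed — (H4) only
bounds the curvature of that tower at O(1/L²); the conclusion is LRO of symmetric sector ground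
states, never an anomalous average.
- Literature.Barriers.HubbardSuperconductivity.WeakCouplingCeiling: bites GappedWindow if the window
is the weak-coupling chiral d+id sliver (parity gap Δ ~ e^{-1/(αρ²U²)}·(id admixture), flat in U,
below any convergent expansion's temperature floor); evasion is partial: PG is a one-particle
(two-point) datum, the kind constructive fermionic RG controls best, and the window may be taken at
intermediate U where no expansion is claimed; the order step is moved into IncommensurateRigidity,
which uses no expansion.
- Literature.Barriers.HubbardSuperconductivity.PerturbativeInvisibilityOfPairing: nothing in the
route reads a scale off a power series in U; PG, (H2)–(H4) are finite-volume inequalities with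
unspecified constants — not in class beyond the WeakCouplingCeiling remark above.
- Literature.Barriers.HubbardSuperconductivity.Ge

Novelty grade: new-combination — route-review grade (refuter 2bdd7c93, 2026-08-15; on top of the planner's and grounder g12-14's searches; my own lit queries this session limited to crossref — openalex budget exhausted, local searchd unavailable). Two known ingredients joined for this statement: (i) Hastings–Koma/Nachtergaele–Sims  (refuter refuter-rreview-route-Langlands-AdjointE-2bdd7c93-0, 2026-08-15T12:33:17Z; prior: HastingsKoma2006 (math-ph/0507008 Thm 6/Cor 7: fermionic clustering under a GLOBAL gap), Koma2007 math-ph/0505022 Thm 3 (intra-sector gap, D<2), doi:10.1103/physrevlett.84.1535 Oshikawa2000; HastingsPRB2004; NachtergaeleSimsCMP2007; doi:10.1063/5.0021511 BachmannEtAl2021 (LSM direction only), doi:10.1103/physrevx.11.021005 ElseThorngrenSenthil2021 (non-rigorous trichotomy), doi:10.1103/physrevb.65)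

sub-problem: HubbardSuperconductivity · status: open · opened planner-plancard-HubbardSuperconductivity-Hub-cfa6fde2-0 2026-08-15T11:02:01Z · rev 4 · ledger route-HubbardSuperconductivity-ParityGapRigidity
GENERATED by the gate from the ledger (D-0016/17). Provers cite these decls: `theorem foo : Summit.HubbardSuperconductivity.HubbardSuperconductivity.Theses.ParityGapRigidity.<Decl> := …` in Summits/HubbardSuperconductivity/HubbardSuperconductivity/Theorems/<Name>.lean.
-/

namespace Summit.HubbardSuperconductivity.HubbardSuperconductivity.Theses.ParityGapRigidity

open scoped BigOperators Topology Manifold Classical MeasureTheory ProbabilityTheory Matrix InnerProductSpace ComplexConjugate ContinuousMap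
open Filter Set Function TopologicalSpace MeasureTheory

attribute [summit_statement] _root_.HubbardSuperconductivity

open Literature.Hubbard

/-- item stmt-HubbardSuperconductivity-2195 · crux · rank 2 · open · by planner
why it might fail: No converse-LSM theorem exists in d=2 (flux insertion gives momentum, never ODLRO); false if the t'=0 Hubbard model has at some (U,δ) a z=1 featureless pair liquid or a fermion-gapped critical point obeying (H1)-(H4) without condensate (none known: Bose metals fail H3, 4e states fail H4).
sources: Oshikawa2000, Oshikawa2003, HastingsPRB2004, NachtergaeleSimsCMP2007, BachmannEtAl2021, ElseThorngrenSenthil2021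
R, the bet: Lieb–Schultz–Mattis/Oshikawa-type rigidity for the Hubbard torus family at non-integer
filling 1−δ ∈ (1/2,1) per site. For every U>0, δ∈(0,1/2): if uniformly in even L ≥ L₀ every
(N_L,0)-sector ground state has (H1) exponentially decaying one-particle density matrix, (H2) normal
fluctuations Var ≤ C·L² of every one-body operator Σ a(p) c†_{p1} c_{p2} with |a| ≤ 1 supported on
pairs at torus distance ≤ 1 (no charge/spin/bond/current density wave at any wavevector), (H3) at
most D eigenvalues of H inside the sector below E₀ + c/L (no gapless neutral continuum, no
topological quasi-degeneracy), (H4) E(N_L±2) − ½[E(N_L)+E(N_L±4)] ≤ C/L² (no charge-4e staircase, no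
z=1 criticality), then every such ground state has uniform Yang ODLRO: a unit pair wavefunction v
with Re v†ρ₂v ≥ a·L². Plain insulators PASS (H1)–(H4), so the non-integer filling is what excludes
them (compressibility deliberately not assumed); 4e condensates fail (H4), Bose surfaces /
orthogonal metals / spinon surfaces fail (H3), density waves fail (H2). Mechanism to be found: flux
insertion + quasi-locality + momentum counting (Oshikawa; Hastings; Nachtergaele–Sims;
Bachmann–Bols–De Roeck–Fraas indices) pushed -/
@[route_item "route-HubbardSuperconductivity-ParityGapRigidity", crux]
def IncommensurateRigidity : Prop :=
  ∀ (U δ : ℝ), 0 < U → δ ∈ Set.Ioo (0 : ℝ) (1 / 2) → (∃ C m : ℝ, 0 < m ∧ ∃ L₀ : ℕ, ∀ L ≥ L₀, Even L → ∀ Hm, Hm = Literature.MathematicalPhysics.QuantumLattice.hubbardTorus 2 L 1 U → ∀ ψ, Literature.MathematicalPhysics.QuantumLattice.IsGroundStateInSector Hm (2 * ⌊(1 - δ) * (L : ℝ) ^ 2 / 2⌋₊) 0 ψ → star ψ ⬝ᵥ ψ = 1 → ∀ (x y : Literature.MathematicalPhysics.QuantumLattice.FermionTorus 2 L) (σ τ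 : Fin 2), ‖Literature.MathematicalPhysics.QuantumLattice.oneParticleRDM ψ (Literature.MathematicalPhysics.QuantumLattice.orb x σ) (Literature.MathematicalPhysics.QuantumLattice.orb y τ)‖ ≤ C * Real.exp (-(m * (Literature.MathematicalPhysics.QuantumLattice.torusDist x.toTorusSite y.toTorusSite : ℝ)))) → (∃ C : ℝ, ∃ L₀ : ℕ, ∀ L ≥ L₀, Even L → ∀ Hm, Hm = Literature.MathematicalPhysics.QuantumLattice.hubbardTorus 2 L 1 U → ∀ ψ, Literature.MathematicalPhysics.QuantumLattice.IsGroundStateInSector Hm (2 * ⌊(1 - δ) * (L : ℝ) ^ 2 / 2⌋₊) 0 ψ → star ψ ⬝ᵥ ψ = 1 → ∀ a : Literature.MathematicalPhysics.QuantumLattice.Orb (Literature.MathematicalPhysics.QuantumLattice.FermionTorus 2 L) × Literature.MathematicalPhysics.QuantumLattice.Orb (Literature.MathematicalPhysics.QuantumLattice.FermionTorus 2 L) → ℂ, (∀ p, ‖a p‖ ≤ 1) → (∀ p, a p ≠ 0 → Literature.MathematicalPhysics.QuantumLattice.torusDist (ofLex p.1).1.toTorusSite (ofLex p.2).1.toTorusSite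 ≤ 1) → (Literature.MathematicalPhysics.QuantumLattice.expect (Matrix.conjTranspose (∑ p, a p • (Literature.MathematicalPhysics.QuantumLattice.creation p.1 * Literature.MathematicalPhysics.QuantumLattice.annihilation p.2)) * (∑ p, a p • (Literature.MathematicalPhysics.QuantumLattice.creation p.1 * Literature.MathematicalPhysics.QuantumLattice.annihilation p.2))) ψ).re - ‖Literature.MathematicalPhysics.QuantumLattice.expect (∑ p, a p • (Literature.MathematicalPhysics.QuantumLattice.creation p.1 * Literature.MathematicalPhysics.QuantumLattice.annihilation p.2)) ψ‖ ^ 2 ≤ C * (L : ℝ) ^ 2) → (∃ c : ℝ, 0 < c ∧ ∃ D L₀ : ℕ, ∀ L ≥ L₀, Even L → ∀ Hm, Hm = Literature.MathematicalPhysics.QuantumLattice.hubbardTorus 2 L 1 U → ∀ V : Submodule ℂ (Literature.MathematicalPhysics.QuantumLattice.Fock (Literature.MathematicalPhysics.QuantumLattice.Orb (Literature.MathematicalPhysics.QuantumLattice.FermionTorus 2 L))), V ≤ Literature.MathematicalPhysics.QuantumLattice.szSector (2 * ⌊(1 - δ) * (L : ℝ) ^ 2 / 2⌋₊) 0 → (∀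 φ ∈ V, (star φ ⬝ᵥ Matrix.mulVec Hm φ).re ≤ (Matrix.minEnergyOn Hm (Literature.MathematicalPhysics.QuantumLattice.szSector (2 * ⌊(1 - δ) * (L : ℝ) ^ 2 / 2⌋₊) 0) + c / (L : ℝ)) * (star φ ⬝ᵥ φ).re) → Module.finrank ℂ V ≤ D) → (∃ C : ℝ, ∃ L₀ : ℕ, ∀ L ≥ L₀, Even L → ∀ Hm, Hm = Literature.MathematicalPhysics.QuantumLattice.hubbardTorus 2 L 1 U → ∀ (E : ℕ → ℝ) (n : ℕ), E = Literature.MathematicalPhysics.QuantumLattice.groundEnergy Hm → n = 2 * ⌊(1 - δ) * (L : ℝ) ^ 2 / 2⌋₊ → E (n + 2) - (E n + E (n + 4)) / 2 ≤ C / (L : ℝ) ^ 2 ∧ E (n - 2) - (E n + E (n - 4)) / 2 ≤ C / (L : ℝ) ^ 2) → ∃ a : ℝ, 0 < a ∧ ∃ L₁ : ℕ, ∀ L ≥ L₁, Even L → ∀ Hm, Hm = Literature.MathematicalPhysics.QuantumLattice.hubbardTorus 2 L 1 U → ∀ ψ, Literature.MathematicalPhysics.QuantumLattice.IsGroundStateInSector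 Hm (2 * ⌊(1 - δ) * (L : ℝ) ^ 2 / 2⌋₊) 0 ψ → star ψ ⬝ᵥ ψ = 1 → ∃ v : Literature.MathematicalPhysics.QuantumLattice.Orb (Literature.MathematicalPhysics.QuantumLattice.FermionTorus 2 L) × Literature.MathematicalPhysics.QuantumLattice.Orb (Literature.MathematicalPhysics.QuantumLattice.FermionTorus 2 L) → ℂ, star v ⬝ᵥ v = 1 ∧ a * (L : ℝ) ^ 2 ≤ (star v ⬝ᵥ Matrix.mulVec (Literature.MathematicalPhysics.QuantumLattice.twoParticleRDM ψ) v).re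

/-- item stmt-HubbardSuperconductivity-2196 · crux · rank 3 · open · by planner
why it might fail: At t'=0 the believed d_{x2-y2} state is nodal (parity gap ~ v_Delta/L, not uniform in L); a fully gapped B1g-containing sliver (d+id at the B1g/B2g Kohn-Luttinger crossing) may not exist for the pure model, and at larger U stripes/density waves violate (H2).
sources: RaghuKivelsonScalapino2010, ArovasBergKivelsonRaghu2022, MatveevLarkin1997, QinEtAl2020, Scalapino1995
Window of the PURE t'=0 model (finite-volume hypotheses only): ∃ U>0, δ∈(0,1/2) such that uniformly
in even L ≥ L₀ and for every (N_L,0)-sector ground state: (PG) one-particle charge gap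
E(N_L+1)+E(N_L−1)−2E₀(N_L,0) ≥ 2Δ > 0 — the Matveev–Larkin parity gap, energies only (Wave0
groundEnergy for the odd sectors, Matrix.minEnergyOn szSector for E₀); false in a Fermi liquid
(~1/L²), marginal (~v_Δ/L) for nodal d_{x²−y²}, uniform in a fully gapped d+id or strong-pairing
state; (H2),(H3),(H4) verbatim as in IncommensurateRigidity; and d-wave dominance κ·L²·Re v†ρ₂(ψ)v ≤
⟨ψ, pairField_d† pairField_d ψ⟩ for all unit v (the n.n. B1g pair field captures a fixed fraction of
the top pair eigenvalue; trivially true without ODLRO since Σ_x⟨P_x†P_x⟩ ~ L², false only for a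
condensate orthogonal to the n.n. B1g bond function). Candidate: chiral d+id sliver at the B1g/B2g
Kohn–Luttinger crossing (n≈0.55–0.65, i.e. δ≈0.35–0.45) at weak-to-intermediate U. Refuter
instrument: ED/DMRG maps of L·[E(N_L±1) − hull] and of the (H3) level count. -/
@[route_item "route-HubbardSuperconductivity-ParityGapRigidity", crux]
def GappedWindow : Prop :=
  ∃ U : ℝ, 0 < U ∧ ∃ δ ∈ Set.Ioo (0 : ℝ) (1 / 2), (∃ Δ : ℝ, 0 < Δ ∧ ∃ L₀ : ℕ, ∀ L ≥ L₀, Even L → ∀ Hm, Hm = Literature.MathematicalPhysics.QuantumLattice.hubbardTorus 2 L 1 U → 2 * Δ ≤ Literature.MathematicalPhysics.QuantumLattice.groundEnergy Hm (2 * ⌊(1 - δ) * (L : ℝ) ^ 2 / 2⌋₊ + 1) + Literature.MathematicalPhysics.QuantumLattice.groundEnergy Hm (2 * ⌊(1 - δ) * (L : ℝ) ^ 2 / 2⌋₊ - 1) - 2 * Matrix.minEnergyOn Hm (Literature.MathematicalPhysics.QuantumLattice.szSector (2 * ⌊(1 - δ) * (L : ℝ) ^ 2 / 2⌋₊) 0))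 ∧ (∃ C : ℝ, ∃ L₀ : ℕ, ∀ L ≥ L₀, Even L → ∀ Hm, Hm = Literature.MathematicalPhysics.QuantumLattice.hubbardTorus 2 L 1 U → ∀ ψ, Literature.MathematicalPhysics.QuantumLattice.IsGroundStateInSector Hm (2 * ⌊(1 - δ) * (L : ℝ) ^ 2 / 2⌋₊) 0 ψ → star ψ ⬝ᵥ ψ = 1 → ∀ a : Literature.MathematicalPhysics.QuantumLattice.Orb (Literature.MathematicalPhysics.QuantumLattice.FermionTorus 2 L) × Literature.MathematicalPhysics.QuantumLattice.Orb (Literature.MathematicalPhysics.QuantumLattice.FermionTorus 2 L) → ℂ, (∀ p, ‖a p‖ ≤ 1) → (∀ p, a p ≠ 0 → Literature.MathematicalPhysics.QuantumLattice.torusDist (ofLex p.1).1.toTorusSite (ofLex p.2).1.toTorusSite ≤ 1) → (Literature.MathematicalPhysics.QuantumLattice.expect (Matrix.conjTranspose (∑ p, a p • (Literature.MathematicalPhysics.QuantumLattice.creation p.1 * Literature.MathematicalPhysics.QuantumLattice.annihilation p.2)) * (∑ p, a p • (Literature.MathematicalPhysics.QuantumLattice.creation p.1 * Literature.MathematicalPhysics.QuantumLattice.annihilation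 p.2))) ψ).re - ‖Literature.MathematicalPhysics.QuantumLattice.expect (∑ p, a p • (Literature.MathematicalPhysics.QuantumLattice.creation p.1 * Literature.MathematicalPhysics.QuantumLattice.annihilation p.2)) ψ‖ ^ 2 ≤ C * (L : ℝ) ^ 2) ∧ (∃ c : ℝ, 0 < c ∧ ∃ D L₀ : ℕ, ∀ L ≥ L₀, Even L → ∀ Hm, Hm = Literature.MathematicalPhysics.QuantumLattice.hubbardTorus 2 L 1 U → ∀ V : Submodule ℂ (Literature.MathematicalPhysics.QuantumLattice.Fock (Literature.MathematicalPhysics.QuantumLattice.Orb (Literature.MathematicalPhysics.QuantumLattice.FermionTorus 2 L))), V ≤ Literature.MathematicalPhysics.QuantumLattice.szSector (2 * ⌊(1 - δ) * (L : ℝ) ^ 2 / 2⌋₊) 0 → (∀ φ ∈ V, (star φ ⬝ᵥ Matrix.mulVec Hm φ).re ≤ (Matrix.minEnergyOn Hm (Literature.MathematicalPhysics.QuantumLattice.szSector (2 * ⌊(1 - δ) * (L : ℝ) ^ 2 / 2⌋₊) 0) + c / (L : ℝ)) * (star φ ⬝ᵥ φ).re) → Module.finrank ℂ V ≤ D) ∧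 (∃ C : ℝ, ∃ L₀ : ℕ, ∀ L ≥ L₀, Even L → ∀ Hm, Hm = Literature.MathematicalPhysics.QuantumLattice.hubbardTorus 2 L 1 U → ∀ (E : ℕ → ℝ) (n : ℕ), E = Literature.MathematicalPhysics.QuantumLattice.groundEnergy Hm → n = 2 * ⌊(1 - δ) * (L : ℝ) ^ 2 / 2⌋₊ → E (n + 2) - (E n + E (n + 4)) / 2 ≤ C / (L : ℝ) ^ 2 ∧ E (n - 2) - (E n + E (n - 4)) / 2 ≤ C / (L : ℝ) ^ 2) ∧ (∃ κ : ℝ, 0 < κ ∧ ∃ L₀ : ℕ, ∀ (L : ℕ) [NeZero L], L₀ ≤ L → Even L → ∀ Hm, Hm = Literature.MathematicalPhysics.QuantumLattice.hubbardTorus 2 L 1 U → ∀ ψ, Literature.MathematicalPhysics.QuantumLattice.IsGroundStateInSector Hm (2 * ⌊(1 - δ) * (L : ℝ) ^ 2 / 2⌋₊) 0 ψ → star ψ ⬝ᵥ ψ = 1 → ∀ v : Literature.MathematicalPhysics.QuantumLattice.Orb (Literature.MathematicalPhysics.QuantumLattice.FermionTorus 2 L) × Literature.MathematicalPhysics.QuantumLattice.Orb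 (Literature.MathematicalPhysics.QuantumLattice.FermionTorus 2 L) → ℂ, star v ⬝ᵥ v = 1 → κ * (L : ℝ) ^ 2 * (star v ⬝ᵥ Matrix.mulVec (Literature.MathematicalPhysics.QuantumLattice.twoParticleRDM ψ) v).re ≤ (Literature.MathematicalPhysics.QuantumLattice.expect (Matrix.conjTranspose (Literature.MathematicalPhysics.QuantumLattice.pairField Literature.MathematicalPhysics.QuantumLattice.dWaveFormFactor L) * Literature.MathematicalPhysics.QuantumLattice.pairField Literature.MathematicalPhysics.QuantumLattice.dWaveFormFactor L) ψ).re)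

/-- item stmt-HubbardSuperconductivity-2197 · support · rank 4 · open · by planner
why it might fail: Constants must be uniform in L and N: needs a torus fermionic Lieb-Robinson bound with volume-independent velocity, and the filter step may use only the one-sided gaps on the N-1 and N+1 sides after the shift H - mu_L N; any hidden use of a full Fock-space gap fails (Goldstone tower in N+-2).
sources: HastingsKoma2006, NachtergaeleSimsYoung2018, NachtergaeleSims2006, Koma2007
Sector-relative Hastings–Koma lemma (Literature-grade, expected provable now): for every U and Δ>0
there are C, m>0 such that on EVERY torus side L and in EVERY sector (N, S^z=0), a normalised sector
ground state ψ of hubbardTorus 2 L 1 U with E(N+1)+E(N−1)−2E₀(N,0) ≥ 2Δ has |ρ₁(ψ)((x,σ),(y,τ))| ≤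
C·exp(−m·torusDist(x,y)). Proof pattern: H' = H − μ_L·N with μ_L = (E(N+1)−E(N−1))/2 has one-sided
gaps ≥ Δ above E₀' on the (N−1)- and (N+1)-particle spaces reached by c_{yτ}ψ and c†_{xσ}ψ;
fermionic Lieb–Robinson bound for {c_x(t), c_y†} on the torus with constants uniform in L and N;
Hastings–Koma Gaussian filtering in t; the ground-projector terms vanish by charge conservation. No
global gap is used, so the N±2 Goldstone tower and phonons never enter. Contrast Koma2007 (gap
inside the sector, D<2). -/
@[route_item "route-HubbardSuperconductivity-ParityGapRigidity", crux]
def ParityGapClustering : Prop :=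
  ∀ (U Δ : ℝ), 0 < Δ → ∃ C m : ℝ, 0 < m ∧ ∀ (L N : ℕ), ∀ Hm, Hm = Literature.MathematicalPhysics.QuantumLattice.hubbardTorus 2 L 1 U → ∀ ψ, Literature.MathematicalPhysics.QuantumLattice.IsGroundStateInSector Hm (N) 0 ψ → star ψ ⬝ᵥ ψ = 1 → 2 * Δ ≤ Literature.MathematicalPhysics.QuantumLattice.groundEnergy Hm (N + 1) + Literature.MathematicalPhysics.QuantumLattice.groundEnergy Hm (N - 1) - 2 * Matrix.minEnergyOn Hm (Literature.MathematicalPhysics.QuantumLattice.szSector (N) 0) → ∀ (x y : Literature.MathematicalPhysics.QuantumLattice.FermionTorus 2 L) (σ τ : Fin 2), ‖Literature.MathematicalPhysics.QuantumLattice.oneParticleRDM ψ (Literature.MathematicalPhysics.QuantumLattice.orb x σ) (Literature.MathematicalPhysics.QuantumLattice.orb y τ)‖ ≤ C * Real.exp (-(m * (Literature.MathematicalPhysics.QuantumLattice.torusDist x.toTorusSite y.toTorusSite : ℝ)))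

/-- item stmt-HubbardSuperconductivity-2198 · support · rank 9 · open · by planner
sources: RaghuKivelsonScalapino2010, ArovasBergKivelsonRaghu2022
Negative side = kill criterion of the route: for every U>0 and δ∈(0,1/2) the pure model has NO
uniform one-particle charge gap about the (N_L,0) ground energy along even L (e.g. because any
pairing state of the t'=0 model is nodal, or absent). A proof closes route ParityGapRigidity
(GappedWindow becomes false); ED/DMRG parity-gap maps are the instrument. Sources:
RaghuKivelsonScalapino2010, ArovasBergKivelsonRaghu2022. -/
@[route_item "route-HubbardSuperconductivity-ParityGapRigidity"]
def NoUniformParityGap : Prop :=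
  ∀ (U δ : ℝ), 0 < U → δ ∈ Set.Ioo (0 : ℝ) (1 / 2) → ¬ (∃ Δ : ℝ, 0 < Δ ∧ ∃ L₀ : ℕ, ∀ L ≥ L₀, Even L → ∀ Hm, Hm = Literature.MathematicalPhysics.QuantumLattice.hubbardTorus 2 L 1 U → 2 * Δ ≤ Literature.MathematicalPhysics.QuantumLattice.groundEnergy Hm (2 * ⌊(1 - δ) * (L : ℝ) ^ 2 / 2⌋₊ + 1) + Literature.MathematicalPhysics.QuantumLattice.groundEnergy Hm (2 * ⌊(1 - δ) * (L : ℝ) ^ 2 / 2⌋₊ - 1) - 2 * Matrix.minEnergyOn Hm (Literature.MathematicalPhysics.QuantumLattice.szSector (2 * ⌊(1 - δ) * (L : ℝ) ^ 2 / 2⌋₊) 0))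

/-- item stmt-HubbardSuperconductivity-2199 · assembly · rank 1 · closed · proved by Summit.HubbardSuperconductivity.HubbardSuperconductivity.Theorems.parityGapRigidity_assembly_proof @ 40b9f4f61040 (prover) · by planner
sources: Scalapino1995, YangODLRO1962
Bookkeeping: GappedWindow gives (U,δ,Δ,…); ParityGapClustering turns PG into (H1);
IncommensurateRigidity gives uniform Yang ODLRO a·L²; d-wave dominance gives ⟨pairField_d†
pairField_d⟩_ψ ≥ κaL⁴ for every (N_L,0)-sector ground state at even L ≥ L₁ (this composition was
machine-checked in the planner's SketchSkeleton.lean). Then for any sequence (N, ψ) as in the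
Statement: Σ_{x,y ∈ halfOpenBox 2 (2k)} torusPullback (pairFieldCorr dWaveFormFactor ψ) (2k) x y =
Re⟨ψ, pairField† pairField ψ⟩ (pairField = Σ_x localPair; torusProj_bijOn_halfOpenBox), which is ≤
c·(2k)⁴ (‖localPair‖ bounded) and ≥ κa(2k)⁴, so the liminf over k of the |Λ|⁻²-normalised sum is ≥
κa > 0: HubbardSuperconductivity. Sources: Scalapino1995, YangODLRO1962. -/
@[route_item "route-HubbardSuperconductivity-ParityGapRigidity"]
def Assembly : Prop :=
  ParityGapClustering → IncommensurateRigidity → GappedWindow → HubbardSuperconductivity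

/-! D-0027 §2.1 — DECIDING THEOREM (planner-authored via `route open/edit --closes-file`; by planner-rbadge-HubbardSuperconductivity-Parity-e98c0bca-g2-0 2026-08-15T16:25:32Z):
its hypotheses are this route's items and its conclusion the sub-problem Statement (glue_lint), and it elaborates with this file. -/

/-- Deciding theorem of route ParityGapRigidity (D-0027 §2.1), proved from the three substantive
items alone (no bookkeeping hypothesis). `GappedWindow` supplies `U, δ`, the uniform parity gap,
(H2)–(H4) and d-wave dominance; `ParityGapClustering` turns the parity gap into (H1);
`IncommensurateRigidity` then gives uniform Yang ODLRO `a·L² ≤ Re v†ρ₂v`; dominance gives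
`κ a L⁴ ≤ Re⟨Δ_d† Δ_d⟩ = Σ_{x,y} G_L(x,y)` (`sum_pairFieldCorr_succ`), the fundamental-domain sum
is the torus sum (`sum_halfOpenBox_torusProj`, `card_halfOpenBox`), and the pointwise bound
`G_L(x,y) ≤ C_d²` (`pairFieldCorr_succ_le`) keeps the real `liminf` off its junk value, so the
`|Λ_{2k}|⁻²`-normalised sums have `liminf ≥ κ a > 0` along the even sides `L = 2k`. -/
@[closes "route-HubbardSuperconductivity-ParityGapRigidity"] theorem closes (hL : ParityGapClustering) (hR : IncommensurateRigidity) (hW : GappedWindow) :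
    _root_.HubbardSuperconductivity := by
  classical
  obtain ⟨U, hU, δ, hδ, ⟨Δ, hΔ, L₀, hPG⟩, hH2, hH3, hH4, ⟨κ, hκ, L₅, hdom⟩⟩ := hW
  obtain ⟨C₁, m, hm, hclus⟩ := hL U Δ hΔ
  obtain ⟨a, ha, L₁, hY⟩ := hR U δ hU hδ
    ⟨C₁, m, hm, L₀, fun L hLL hev Hm hHm φ hgs hn =>
      hclus L _ Hm hHm φ hgs hn (hPG L hLL hev Hm hHm)⟩ hH2 hH3 hH4
  refine ⟨U, hU, δ, hδ, fun N ψ hyp => ?_⟩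
  -- (1) Σ_{x,y ∈ torus} G_L(x,y) = Re⟨Δ_d† Δ_d⟩ at every positive side
  have hsumG : ∀ (L : ℕ) [NeZero L],
      ∑ x : Literature.Probability.LatticeModels.TorusSite 2 L, ∑ y,
          Literature.MathematicalPhysics.QuantumLattice.pairFieldCorr
            Literature.MathematicalPhysics.QuantumLattice.dWaveFormFactor ψ L x y =
        (Literature.MathematicalPhysics.QuantumLattice.expect
          ((Literature.MathematicalPhysics.QuantumLattice.pairField
              Literature.MathematicalPhysics.QuantumLattice.dWaveFormFactor L)ᴴ *
            Literature.MathematicalPhysics.QuantumLattice.pairField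
              Literature.MathematicalPhysics.QuantumLattice.dWaveFormFactor L) (ψ L)).re := by
    intro L _
    obtain ⟨n, rfl⟩ := Nat.exists_eq_succ_of_ne_zero (NeZero.ne L)
    exact Literature.MathematicalPhysics.QuantumLattice.sum_pairFieldCorr_succ _ ψ n
  -- (2) the two-point function of a normalised state is bounded, uniformly in the side
  obtain ⟨B, hupG⟩ : ∃ B : ℝ, ∀ (L : ℕ) [NeZero L], star (ψ L) ⬝ᵥ ψ L = 1 →
      ∀ x y : Literature.Probability.LatticeModels.TorusSite 2 L,
        Literature.MathematicalPhysics.QuantumLattice.pairFieldCorr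
            Literature.MathematicalPhysics.QuantumLattice.dWaveFormFactor ψ L x y ≤ B := by
    refine ⟨(∑ e ∈ insert 0 Literature.MathematicalPhysics.QuantumLattice.unitSteps,
      ‖((Literature.MathematicalPhysics.QuantumLattice.dWaveFormFactor e / Real.sqrt 2 : ℝ) : ℂ)‖ *
        2) ^ 2, ?_⟩
    intro L _ hψ x y
    obtain ⟨n, rfl⟩ := Nat.exists_eq_succ_of_ne_zero (NeZero.ne L)
    exact Literature.MathematicalPhysics.QuantumLattice.pairFieldCorr_succ_le _ ψ n hψ x y
  -- (3) thresholds: even sides 2k with k ≥ K are ≥ L₁ (rigidity), ≥ L₅ (dominance) and positive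
  obtain ⟨K, hK1, hKL₁, hKL₅⟩ : ∃ K : ℕ, 1 ≤ K ∧ L₁ ≤ 2 * K ∧ L₅ ≤ 2 * K :=
    ⟨L₁ + L₅ + 1, by omega, by omega, by omega⟩
  -- (4) two-sided bounds on the normalised fundamental-domain sums along L = 2k, k ≥ K
  have hpt : ∀ k : ℕ, K ≤ k →
      κ * a ≤ (∑ x ∈ Literature.Probability.LatticeModels.halfOpenBox 2 (2 * k),
          ∑ y ∈ Literature.Probability.LatticeModels.halfOpenBox 2 (2 * k),
            Literature.MathematicalPhysics.QuantumLattice.torusPullback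
              (Literature.MathematicalPhysics.QuantumLattice.pairFieldCorr
                Literature.MathematicalPhysics.QuantumLattice.dWaveFormFactor ψ) (2 * k) x y) /
          ((Literature.Probability.LatticeModels.halfOpenBox 2 (2 * k)).card : ℝ) ^ 2 ∧
      (∑ x ∈ Literature.Probability.LatticeModels.halfOpenBox 2 (2 * k),
          ∑ y ∈ Literature.Probability.LatticeModels.halfOpenBox 2 (2 * k),
            Literature.MathematicalPhysics.QuantumLattice.torusPullback
              (Literature.MathematicalPhysics.QuantumLattice.pairFieldCorr
                Literature.MathematicalPhysics.QuantumLattice.dWaveFormFactor ψ) (2 * k) x y) /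
          ((Literature.Probability.LatticeModels.halfOpenBox 2 (2 * k)).card : ℝ) ^ 2 ≤ B := by
    intro k hk
    haveI : NeZero (2 * k) := ⟨by omega⟩
    obtain ⟨hN, hnorm, hgs⟩ := hyp (2 * k) (even_two_mul k)
    rw [hN] at hgs
    obtain ⟨v, hv, hav⟩ := hY (2 * k) (by omega) (even_two_mul k) _ rfl (ψ (2 * k)) hgs hnorm
    have hd := hdom (2 * k) (by omega) (even_two_mul k) _ rfl (ψ (2 * k)) hgs hnorm v hv
    have hk0 : (0 : ℝ) < ((2 * k : ℕ) : ℝ) := by exact_mod_cast (by omega : 0 < 2 * k)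
    have hpos : (0 : ℝ) < ((2 * k : ℕ) : ℝ) ^ 4 := pow_pos hk0 4
    have hcard : (((Literature.Probability.LatticeModels.halfOpenBox 2 (2 * k)).card : ℕ) : ℝ) ^ 2 =
        ((2 * k : ℕ) : ℝ) ^ 4 := by
      rw [Literature.Probability.LatticeModels.card_halfOpenBox]
      push_cast
      ring
    have hnum : (∑ x ∈ Literature.Probability.LatticeModels.halfOpenBox 2 (2 * k),
          ∑ y ∈ Literature.Probability.LatticeModels.halfOpenBox 2 (2 * k),
            Literature.MathematicalPhysics.QuantumLattice.torusPullback
              (Literature.MathematicalPhysics.QuantumLattice.pairFieldCorr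
                Literature.MathematicalPhysics.QuantumLattice.dWaveFormFactor ψ) (2 * k) x y) =
        ∑ x : Literature.Probability.LatticeModels.TorusSite 2 (2 * k), ∑ y,
          Literature.MathematicalPhysics.QuantumLattice.pairFieldCorr
            Literature.MathematicalPhysics.QuantumLattice.dWaveFormFactor ψ (2 * k) x y := by
      simp only [Literature.MathematicalPhysics.QuantumLattice.torusPullback_apply]
      rw [Literature.MathematicalPhysics.QuantumLattice.sum_halfOpenBox_torusProj (2 * k)
        (fun x => ∑ y ∈ Literature.Probability.LatticeModels.halfOpenBox 2 (2 * k),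
          Literature.MathematicalPhysics.QuantumLattice.pairFieldCorr
            Literature.MathematicalPhysics.QuantumLattice.dWaveFormFactor ψ (2 * k) x
              (Literature.Probability.LatticeModels.Torus.proj (2 * k) y))]
      exact Finset.sum_congr rfl fun x _ =>
        Literature.MathematicalPhysics.QuantumLattice.sum_halfOpenBox_torusProj (2 * k) fun y =>
          Literature.MathematicalPhysics.QuantumLattice.pairFieldCorr
            Literature.MathematicalPhysics.QuantumLattice.dWaveFormFactor ψ (2 * k) x y
    rw [hcard, hnum]
    constructor
    · rw [le_div_iff₀ hpos, hsumG (2 * k)]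
      calc κ * a * ((2 * k : ℕ) : ℝ) ^ 4
          = κ * ((2 * k : ℕ) : ℝ) ^ 2 * (a * ((2 * k : ℕ) : ℝ) ^ 2) := by ring
        _ ≤ κ * ((2 * k : ℕ) : ℝ) ^ 2 *
              (star v ⬝ᵥ Matrix.mulVec
                (Literature.MathematicalPhysics.QuantumLattice.twoParticleRDM (ψ (2 * k))) v).re :=
            mul_le_mul_of_nonneg_left hav (mul_nonneg hκ.le (pow_nonneg hk0.le 2))
        _ ≤ _ := hd
    · rw [div_le_iff₀ hpos]
      calc ∑ x : Literature.Probability.LatticeModels.TorusSite 2 (2 * k), ∑ y,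
            Literature.MathematicalPhysics.QuantumLattice.pairFieldCorr
              Literature.MathematicalPhysics.QuantumLattice.dWaveFormFactor ψ (2 * k) x y
          ≤ ∑ x : Literature.Probability.LatticeModels.TorusSite 2 (2 * k),
              ∑ y : Literature.Probability.LatticeModels.TorusSite 2 (2 * k), B :=
            Finset.sum_le_sum fun x _ => Finset.sum_le_sum fun y _ => hupG (2 * k) hnorm x y
        _ = B * ((2 * k : ℕ) : ℝ) ^ 4 := by
            simp only [Finset.sum_const, Finset.card_univ, Fintype.card_pi, ZMod.card,
              Finset.prod_const, Fintype.card_fin, nsmul_eq_mul]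
            push_cast
            ring
  -- (5) conclude: 0 < κ a ≤ liminf of the normalised sums (bounded above by B, so no junk value)
  dsimp only [Literature.Probability.LatticeModels.HasLongRangeOrder]
  refine lt_of_lt_of_le (mul_pos hκ ha) (Filter.le_liminf_of_le ?_ ?_)
  · exact Filter.isCoboundedUnder_ge_of_eventually_le _
      (Filter.eventually_atTop.2 ⟨K, fun k hk => (hpt k hk).2⟩)
  · exact Filter.eventually_atTop.2 ⟨K, fun k hk => (hpt k hk).1⟩

end Summit.HubbardSuperconductivity.HubbardSuperconductivity.Theses.ParityGapRigidity
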